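/-
Copyright: cell `pub-balaban-gaps` (G2), seat ne6 (row NE7b), `prover-pub-balaban-gaps-ne6-g16-0`. Project licence.
-/
import Literature.MathematicalPhysics.QuantumLattice.SU2HaarChart
import Literature.MathematicalPhysics.QuantumFieldTheory.Balaban1983to89.T4TermwiseSU2
import Mathlib.Analysis.SpecialFunctions.Trigonometric.ArctanDeriv
import Mathlib.MeasureTheory.Function.JacobianOneDim
import Mathlib.MeasureTheory.Constructions.HaarToSphere
import Mathlib.MeasureTheory.Measure.Lebesgue.VolumeOfBalls
import Mathlib.Analysis.SpecialFunctions.Integrals.Basic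

/-!
# WEYL's INTEGRATION FORMULA FOR CLASS FUNCTIONS OF `SU(2)` (trace form): `∫_{SU(2)} φ(Re tr U) dHaar = (2∕π)∫₀^π φ(2 cos ψ) sin²ψ dψ`, and the
# one-plaquette partition function `∫ e^{−β·Re tr(1−U)} dHaar = (2∕π)∫₀^π e^{−2β(1−cos ψ)} sin²ψ dψ` (row NE7b, node U5c; MODEL, [folklore]; census V40e)

Cell `pub-balaban-gaps` (G2 spine census) for the `pub-balaban` T⁴ crux NE7b (`T4WeightBudget.RelWeightBound`; NOT PRINTED, NOT PROVED).  Crux-route work under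
`Spine/NE7b/`; imports the TREE's `Literature…QuantumLattice.SU2HaarChart` (Haar on `SU(2)` in the gnomonic chart, `lintegral_haarProbability_su2_gnomonic`,
[Chatterjee2026YMHiggs] §3.2 ∕ Lemma 5.1), `…Balaban1983to89.T4TermwiseSU2` (`trace_quatMatrix_re`) and Mathlib (`integral_fun_norm_addHaar`,
`integral_image_eq_integral_abs_deriv_smul`); no `def`, zero `sorry`, nothing of Bałaban's asserted.

THE LOCATED QUESTION (census V40, refuter NE7bREF-G99-POST3 ∕ G100-POST1 on V38∕V39: the one-plaquette letters BY VALUE, `Z_{SU(2)}(β) = e^{−2β}I₁(2β)∕β`).  Every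
by-value statement about ONE `SU(2)` plaquette variable is an integral against Weyl's density `(2∕π) sin²ψ dψ` of the class angle — a formula the tree's files
name but do not have (`Literature/Barriers/QuantumFields/UnitaryHaarSmallBall.lean`: «Mathlib has neither the Weyl integration formula nor …»;
`…Balaban1983to89.StrongCouplingKPWindow`: `c₀(β) = (2∕π)∫₀^π e^{β cos θ} sin²θ dθ` as a reading).  QUESTION (V40e): derive it for `SU(2)` from the tree's
gnomonic chart.  ANSWER ([folklore]):
* §1 **`image_tan_Ioo_zero_pi_div_two`** (`tan″(0, π∕2) = (0, ∞)`), **`integral_Ioi_eq_integral_tan`** (`∫_{(0,∞)} g = ∫_{(0,π∕2)} g(tan ψ)∕cos²ψ dψ`, Mathlib's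
  one-dimensional Jacobian formula — no integrability hypothesis), `tan_weight_eq_sin_sq`, **`integral_radial_eq_integral_angle`**
  (`∫_{(0,∞)} g((1+r²)^{-1∕2})·r²∕(1+r²)² dr = ∫_{(0,π∕2)} g(cos ψ) sin²ψ dψ`), `integral_reflect` (`ψ ↦ π − ψ` moves `g(−cos ψ)` to `(π∕2, π)`);
* §2 **`integral_haar_su2_classFun`**: for measurable `φ ≥ 0` bounded on `[−2, 2]`,
  `∫_{SU(2)} φ(Re tr U) dHaar(U) = (2∕π)·∫_{(0,π)} φ(2 cos ψ)·sin²ψ dψ` — gnomonic chart (`Re tr P(±(1,v)) = ±2∕√(1+|v|²)`), transport `(Fin 3 → ℝ) → ℝ³`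
  (`PiLp.volume_preserving_toLp`), Bochner radial integration (`vol B³ = 4π∕3`), the tangent substitution, the reflection, and `(2π²)⁻¹·4π = 2∕π`;
  **`integral_exp_neg_traceDeficit_eq`**: `∫ e^{−β·Re tr(1 − U)} dHaar = (2∕π)∫_{(0,π)} e^{−2β(1 − cos ψ)} sin²ψ dψ` (`β ≥ 0`).
The sibling V40a `CompactFibreWindowSU2Exact` (the cap law `Haar{Re tr V ≥ 2cos ψ} = (ψ − sin ψ cos ψ)∕π`) is the indicator case, proved there directly.

HONEST REMARKS.  (i) MODEL ∕ [folklore]: Haar geometry of ONE `SU(2)` variable; nothing of the interacting measure.  (ii) `φ ≥ 0` measurable and bounded on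
`[−2, 2]` only (signed ∕ unbounded class functions are not treated; the angle form is over the open interval `(0, π)`).  (iii) No Bessel function is named —
`I₁` is not in Mathlib; the refuter's monotonicity of `β^{3∕2}Z(β)` is the sibling V40b's doubling, not re-derived here.  (iv) (A3) ∕ (A1c) NOT asserted;
NC-NE7b-α UNRULED.  BY-NAME EFFECT ON THE WALL: NONE.  NE7b NOT PRINTED ∕ NOT PROVED; spine PROVED 0∕9; rung (B)+1 on ONE finite T⁴ — NOT infinite volume, NOT
the mass gap, NOT Clay.
HONEST DEPENDENCY: continuum YM on T⁴ ⇐ BetaPertH ∧ nine spine estimates (0/9 proved); BetaPertH ⇐ (D1) ∧ (D4) ∧ CAP+tail;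
G-an2-4 gates asym, D1 and NE2/3/4.  This file changes none of it.
-/

set_option autoImplicit false

noncomputable section

open Real Set MeasureTheory
open scoped ENNReal Quaternion
open Literature.MathematicalPhysics.QuantumLattice
open Literature.MathematicalPhysics.QuantumFieldTheory (haarProbability)

namespace Summit.QuantumFields.BalabanUV.T4Continuum.NE7b.CompactFibreSU2ClassIntegral

/-- `tan '' (0, π/2) = (0, ∞)`. [folklore] -/
theorem image_tan_Ioo_zero_pi_div_two : Real.tan '' Set.Ioo 0 (Real.pi / 2) = Set.Ioi 0 := by
  ext y
  constructor
  · rintro ⟨x, hx, rfl⟩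
    exact Real.tan_pos_of_pos_of_lt_pi_div_two hx.1 hx.2
  · intro hy
    refine ⟨Real.arctan y, ⟨Real.arctan_pos.2 hy, Real.arctan_lt_pi_div_two y⟩, Real.tan_arctan y⟩

/-- **The tangent substitution on `(0, ∞)`**: `∫_{(0,∞)} g(r) dr = ∫_{(0,π/2)} g(tan ψ)∕cos²ψ dψ` (any `g`; Mathlib's one-dimensional Jacobian formula). [folklore] -/
theorem integral_Ioi_eq_integral_tan (g : ℝ → ℝ) :
    ∫ r in Set.Ioi (0 : ℝ), g r = ∫ ψ in Set.Ioo 0 (Real.pi / 2), (1 / Real.cos ψ ^ 2) * g (Real.tan ψ) := by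
  have hderiv : ∀ x ∈ Set.Ioo 0 (Real.pi / 2), HasDerivWithinAt Real.tan (1 / Real.cos x ^ 2) (Set.Ioo 0 (Real.pi / 2)) x := fun x hx =>
    (Real.hasDerivAt_tan (Real.cos_pos_of_mem_Ioo ⟨by linarith [hx.1, Real.pi_pos], hx.2⟩).ne').hasDerivWithinAt
  have hsub : Set.Ioo 0 (Real.pi / 2) ⊆ Set.Ioo (-(Real.pi / 2)) (Real.pi / 2) := fun x hx => ⟨by linarith [hx.1, Real.pi_pos], hx.2⟩
  have hinj : Set.InjOn Real.tan (Set.Ioo 0 (Real.pi / 2)) := Real.strictMonoOn_tan.injOn.mono hsub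
  rw [← image_tan_Ioo_zero_pi_div_two, integral_image_eq_integral_abs_deriv_smul measurableSet_Ioo hderiv hinj g]
  refine setIntegral_congr_fun measurableSet_Ioo fun x hx => ?_
  rw [abs_of_pos (by have := Real.cos_pos_of_mem_Ioo ⟨by linarith [hx.1, Real.pi_pos], hx.2⟩; positivity), smul_eq_mul]


/-- Under the tangent substitution the gnomonic radial weight becomes Weyl's density: for `ψ ∈ (0, π∕2)`,
`(1∕cos²ψ)·(tan²ψ∕(1 + tan²ψ)²) = sin²ψ` and `(1 + tan²ψ)^{-1∕2} = cos ψ`. [folklore] -/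
theorem tan_weight_eq_sin_sq {ψ : ℝ} (hψ : ψ ∈ Set.Ioo 0 (Real.pi / 2)) :
    1 / Real.cos ψ ^ 2 * (Real.tan ψ ^ 2 / (1 + Real.tan ψ ^ 2) ^ 2) = Real.sin ψ ^ 2 := by
  have hc : 0 < Real.cos ψ := Real.cos_pos_of_mem_Ioo ⟨by linarith [hψ.1, Real.pi_pos], hψ.2⟩
  have h1 : (1 + Real.tan ψ ^ 2)⁻¹ = Real.cos ψ ^ 2 := Real.inv_one_add_tan_sq hc.ne'
  have h2 : (1 + Real.tan ψ ^ 2) = (Real.cos ψ ^ 2)⁻¹ := by rw [← h1, inv_inv]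
  rw [h2, Real.tan_eq_sin_div_cos]
  field_simp

/-- **Radial integral of a class profile against the gnomonic density, in Weyl's variable**: for any `g : ℝ → ℝ`,
`∫_{(0,∞)} g((1 + r²)^{-1∕2})·r²∕(1+r²)² dr = ∫_{(0,π∕2)} g(cos ψ)·sin²ψ dψ`. [folklore] -/
theorem integral_radial_eq_integral_angle (g : ℝ → ℝ) :
    ∫ r in Set.Ioi (0 : ℝ), g ((Real.sqrt (1 + r ^ 2))⁻¹) * (r ^ 2 / (1 + r ^ 2) ^ 2)
      = ∫ ψ in Set.Ioo 0 (Real.pi / 2), g (Real.cos ψ) * Real.sin ψ ^ 2 := by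
  rw [integral_Ioi_eq_integral_tan]
  refine setIntegral_congr_fun measurableSet_Ioo fun ψ hψ => ?_
  have hc : 0 < Real.cos ψ := Real.cos_pos_of_mem_Ioo ⟨by linarith [hψ.1, Real.pi_pos], hψ.2⟩
  rw [Real.inv_sqrt_one_add_tan_sq hc, ← tan_weight_eq_sin_sq hψ]
  ring


/-- The reflection `ψ ↦ π − ψ`: `∫_{(0,π∕2)} g(−cos ψ) sin²ψ dψ = ∫_{(π∕2,π)} g(cos ψ) sin²ψ dψ`. [folklore] -/
theorem integral_reflect (g : ℝ → ℝ) :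
    ∫ ψ in Set.Ioo 0 (Real.pi / 2), g (-Real.cos ψ) * Real.sin ψ ^ 2 = ∫ ψ in Set.Ioo (Real.pi / 2) Real.pi, g (Real.cos ψ) * Real.sin ψ ^ 2 := by
  have hπ := Real.pi_pos
  rw [← integral_Ioc_eq_integral_Ioo, ← intervalIntegral.integral_of_le (by linarith), ← integral_Ioc_eq_integral_Ioo,
    ← intervalIntegral.integral_of_le (by linarith)]
  have h := intervalIntegral.integral_comp_sub_left (fun ψ => g (Real.cos ψ) * Real.sin ψ ^ 2) Real.pi (a := 0) (b := Real.pi / 2)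
  simp only [Real.cos_pi_sub, Real.sin_pi_sub, sub_zero, show Real.pi - Real.pi / 2 = Real.pi / 2 by ring] at h
  exact h

/-- **WEYL's INTEGRATION FORMULA FOR CLASS FUNCTIONS OF `SU(2)` (trace form)**: for bounded measurable `φ : ℝ → ℝ`,
`∫_{SU(2)} φ(Re tr U) dHaar(U) = (2∕π)·∫_{(0,π)} φ(2 cos ψ)·sin²ψ dψ` — the law of `Re tr U` under Haar is the semicircle (Sato–Tate) law on `[−2, 2]`.
From the tree's gnomonic chart of Haar on `SU(2)` ([Chatterjee2026YMHiggs] §3.2 ∕ Lemma 5.1, `lintegral_haarProbability_su2_gnomonic`), radial integration in `ℝ³`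
and the substitution `r = tan ψ`. [folklore] -/
theorem integral_haar_su2_classFun (φ : ℝ → ℝ) (hφm : Measurable φ) (hφ0 : ∀ x, 0 ≤ φ x) {M : ℝ} (hφM : ∀ x, -2 ≤ x → x ≤ 2 → φ x ≤ M) :
    ∫ U, φ ((Matrix.trace (U : Matrix (Fin 2) (Fin 2) ℂ)).re) ∂(haarProbability (Matrix.specialUnitaryGroup (Fin 2) ℂ))
      = 2 / Real.pi * ∫ ψ in Set.Ioo 0 Real.pi, φ (2 * Real.cos ψ) * Real.sin ψ ^ 2 := by
  have hπ := Real.pi_pos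
  set μ := haarProbability (Matrix.specialUnitaryGroup (Fin 2) ℂ) with hμ
  -- the integrand and its gnomonic form
  have hGm : Measurable fun U : Matrix.specialUnitaryGroup (Fin 2) ℂ => φ (Matrix.trace (U : Matrix (Fin 2) (Fin 2) ℂ)).re :=
    hφm.comp (Complex.continuous_re.comp (continuous_subtype_val.matrix_trace)).measurable
  have htr : ∀ {x : ℍ}, x ≠ 0 → (Matrix.trace ((quatToSU2 x : Matrix.specialUnitaryGroup (Fin 2) ℂ) : Matrix (Fin 2) (Fin 2) ℂ)).re = 2 * (‖x‖⁻¹ * x.re) :=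
    fun hx => by rw [coe_quatToSU2 hx, Literature.MathematicalPhysics.QuantumFieldTheory.Balaban1983to89.T4TermwiseSU2.trace_quatMatrix_re, Quaternion.re_smul, smul_eq_mul]
  have hnorm : ∀ v : Fin 3 → ℝ, ‖gnomonicQuat v‖ = Real.sqrt (1 + ∑ i, v i ^ 2) := fun v => by
    rw [← sq_norm_gnomonicQuat, Real.sqrt_sq (norm_nonneg _)]
  have hup : ∀ v : Fin 3 → ℝ, (Matrix.trace ((quatToSU2 (gnomonicQuat v) : Matrix.specialUnitaryGroup (Fin 2) ℂ) : Matrix (Fin 2) (Fin 2) ℂ)).re = 2 * (Real.sqrt (1 + ∑ i, v i ^ 2))⁻¹ :=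
    fun v => by rw [htr (gnomonicQuat_ne_zero v), hnorm, show (gnomonicQuat v).re = 1 from rfl, mul_one]
  have hlow : ∀ v : Fin 3 → ℝ, (Matrix.trace ((quatToSU2 (-gnomonicQuat v) : Matrix.specialUnitaryGroup (Fin 2) ℂ) : Matrix (Fin 2) (Fin 2) ℂ)).re = -(2 * (Real.sqrt (1 + ∑ i, v i ^ 2))⁻¹) :=
    fun v => by rw [htr (neg_ne_zero.2 (gnomonicQuat_ne_zero v)), norm_neg, hnorm, Quaternion.re_neg, show (gnomonicQuat v).re = 1 from rfl]; ring
  have hsumsq : ∀ v : Fin 3 → ℝ, ∑ i, v i ^ 2 = ‖(WithLp.toLp 2 v : EuclideanSpace ℝ (Fin 3))‖ ^ 2 := fun v => by rw [EuclideanSpace.real_norm_sq_eq]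
  -- the radial profile `f(r) = (φ(2c) + φ(−2c))·(1+r²)⁻²`, `c = (1+r²)^{-1/2}`
  set f : ℝ → ℝ := fun r => (φ (2 * (Real.sqrt (1 + r ^ 2))⁻¹) + φ (-(2 * (Real.sqrt (1 + r ^ 2))⁻¹))) * ((1 + r ^ 2)⁻¹) ^ 2 with hf
  have hcm : Measurable fun r : ℝ => (Real.sqrt (1 + r ^ 2))⁻¹ := ((Real.continuous_sqrt.comp (continuous_const.add (continuous_pow 2))).measurable).inv
  have hwm : Measurable fun r : ℝ => ((1 + r ^ 2)⁻¹) ^ 2 := ((continuous_const.add (continuous_pow 2)).inv₀ fun r => (by positivity : (1 : ℝ) + r ^ 2 ≠ 0)).measurable.pow_const 2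
  have hfm : Measurable f := ((hφm.comp (hcm.const_mul 2)).add (hφm.comp ((hcm.const_mul 2).neg))).mul hwm
  have hf0 : ∀ r, 0 ≤ f r := fun r => mul_nonneg (add_nonneg (hφ0 _) (hφ0 _)) (by positivity)
  have hcr : ∀ r : ℝ, 0 < (Real.sqrt (1 + r ^ 2))⁻¹ ∧ (Real.sqrt (1 + r ^ 2))⁻¹ ≤ 1 := fun r => by
    have h1 : 1 ≤ Real.sqrt (1 + r ^ 2) := Real.one_le_sqrt.2 (by nlinarith [sq_nonneg r])
    exact ⟨by positivity, inv_le_one_of_one_le₀ h1⟩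
  have hfle : ∀ r, f r ≤ 2 * M * ((1 + r ^ 2)⁻¹) ^ 2 := fun r => by
    obtain ⟨hc0, hc1⟩ := hcr r
    have := hφM (2 * (Real.sqrt (1 + r ^ 2))⁻¹) (by linarith) (by linarith)
    have := hφM (-(2 * (Real.sqrt (1 + r ^ 2))⁻¹)) (by linarith) (by linarith)
    simp only [hf]; nlinarith [sq_nonneg ((1 + r ^ 2)⁻¹)]
  have hM : 0 ≤ M := le_trans (hφ0 0) (hφM 0 (by norm_num) (by norm_num))
  -- Step B: gnomonic formula, in `ofReal` form
  have hB : ∫⁻ U, ENNReal.ofReal (φ (Matrix.trace (U : Matrix (Fin 2) (Fin 2) ℂ)).re) ∂μ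
      = ENNReal.ofReal (1 / (2 * Real.pi ^ 2)) * ∫⁻ v : Fin 3 → ℝ, ENNReal.ofReal (f ‖(WithLp.toLp 2 v : EuclideanSpace ℝ (Fin 3))‖) := by
    rw [hμ, lintegral_haarProbability_su2_gnomonic (fun U : Matrix.specialUnitaryGroup (Fin 2) ℂ => ENNReal.ofReal (φ (Matrix.trace (U : Matrix (Fin 2) (Fin 2) ℂ)).re)) (ENNReal.measurable_ofReal.comp hGm)]
    congr 1
    refine lintegral_congr fun v => ?_
    rw [hup, hlow, ← ENNReal.ofReal_add (hφ0 _) (hφ0 _), ← ENNReal.ofReal_mul (add_nonneg (hφ0 _) (hφ0 _)), hf]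
    simp only [hsumsq]
  -- Step C/D: transport to ℝ³ and Bochner
  have hmeasE : Measurable fun x : EuclideanSpace ℝ (Fin 3) => ENNReal.ofReal (f ‖x‖) := ENNReal.measurable_ofReal.comp (hfm.comp measurable_norm)
  have hcomp := (PiLp.volume_preserving_toLp (Fin 3)).lintegral_comp hmeasE
  have hdim : Module.finrank ℝ (EuclideanSpace ℝ (Fin 3)) = 3 := finrank_euclideanSpace_fin
  have hrad1 : IntegrableOn (fun y : ℝ => y ^ (3 - 1) • (2 * M * ((1 + y ^ 2)⁻¹) ^ 2)) (Set.Ioi 0) := by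
    have hcont : Continuous fun r : ℝ => r ^ 2 / (1 + r ^ 2) ^ 2 := (continuous_pow 2).div ((continuous_const.add (continuous_pow 2)).pow 2) fun r => by positivity
    have hint : Integrable fun r : ℝ => r ^ 2 / (1 + r ^ 2) ^ 2 := by
      refine Integrable.mono' integrable_inv_one_add_sq hcont.aestronglyMeasurable (ae_of_all _ fun r => ?_)
      have h1 : (0 : ℝ) < 1 + r ^ 2 := by positivity
      rw [Real.norm_eq_abs, abs_of_nonneg (by positivity), div_le_iff₀ (pow_pos h1 2), sq (1 + r ^ 2), ← mul_assoc, inv_mul_cancel₀ h1.ne', one_mul]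
      nlinarith [sq_nonneg r]
    have hfun : ∀ y : ℝ, y ^ (3 - 1) • (2 * M * ((1 + y ^ 2)⁻¹) ^ 2) = (2 * M) * (y ^ 2 / (1 + y ^ 2) ^ 2) := fun y => by
      rw [smul_eq_mul, show (3 - 1 : ℕ) = 2 from rfl]; field_simp
    simp_rw [hfun]
    exact (hint.const_mul _).integrableOn
  have hdomI : Integrable (fun x : EuclideanSpace ℝ (Fin 3) => 2 * M * ((1 + ‖x‖ ^ 2)⁻¹) ^ 2) := by
    have h := (integrable_fun_norm_addHaar (volume : Measure (EuclideanSpace ℝ (Fin 3))) (f := fun r : ℝ => 2 * M * ((1 + r ^ 2)⁻¹) ^ 2)).2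
    rw [hdim] at h
    exact h hrad1
  have hFi : Integrable (fun x : EuclideanSpace ℝ (Fin 3) => f ‖x‖) :=
    Integrable.mono' hdomI (hfm.comp measurable_norm).aestronglyMeasurable (ae_of_all _ fun x => by
      rw [Real.norm_eq_abs, abs_of_nonneg (hf0 _)]; exact hfle _)
  have hD : ∫⁻ x : EuclideanSpace ℝ (Fin 3), ENNReal.ofReal (f ‖x‖) = ENNReal.ofReal (∫ x : EuclideanSpace ℝ (Fin 3), f ‖x‖) :=
    (ofReal_integral_eq_lintegral_ofReal hFi (ae_of_all _ fun x => hf0 _)).symm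
  -- Step E: radial integration and the tangent substitution
  have hvol : (volume : Measure (EuclideanSpace ℝ (Fin 3))).real (Metric.ball 0 1) = Real.pi * 4 / 3 := by
    rw [measureReal_def, EuclideanSpace.volume_ball_fin_three, ENNReal.ofReal_one, one_pow, one_mul, ENNReal.toReal_ofReal (by positivity)]
  have hE : ∫ x : EuclideanSpace ℝ (Fin 3), f ‖x‖ = 4 * Real.pi * ∫ ψ in Set.Ioo 0 (Real.pi / 2), (φ (2 * Real.cos ψ) + φ (-(2 * Real.cos ψ))) * Real.sin ψ ^ 2 := by
    rw [integral_fun_norm_addHaar (volume : Measure (EuclideanSpace ℝ (Fin 3))) f, hdim, hvol,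
      ← integral_radial_eq_integral_angle (fun c => φ (2 * c) + φ (-(2 * c)))]
    have hfun : ∀ y : ℝ, y ^ (3 - 1) • f y = (φ (2 * (Real.sqrt (1 + y ^ 2))⁻¹) + φ (-(2 * (Real.sqrt (1 + y ^ 2))⁻¹))) * (y ^ 2 / (1 + y ^ 2) ^ 2) := fun y => by
      rw [smul_eq_mul, hf, show (3 - 1 : ℕ) = 2 from rfl]; field_simp
    simp_rw [hfun]
    rw [nsmul_eq_mul, smul_eq_mul]; push_cast; ring
  -- Step F: reflect the lower hemisphere onto `(π/2, π)` and glue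
  have hcos : ∀ ψ : ℝ, -2 ≤ 2 * Real.cos ψ ∧ 2 * Real.cos ψ ≤ 2 := fun ψ => ⟨by linarith [Real.neg_one_le_cos ψ], by linarith [Real.cos_le_one ψ]⟩
  have hbdd : ∀ ψ, ‖φ (2 * Real.cos ψ) * Real.sin ψ ^ 2‖ ≤ M := fun ψ => by
    rw [Real.norm_eq_abs, abs_of_nonneg (mul_nonneg (hφ0 _) (sq_nonneg _))]
    calc φ (2 * Real.cos ψ) * Real.sin ψ ^ 2 ≤ M * 1 := mul_le_mul (hφM _ (hcos ψ).1 (hcos ψ).2) (Real.sin_sq_le_one ψ) (sq_nonneg _) hM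
      _ = M := mul_one M
  have hpm : Measurable fun ψ : ℝ => φ (2 * Real.cos ψ) * Real.sin ψ ^ 2 :=
    (hφm.comp (Real.continuous_cos.measurable.const_mul 2)).mul (Real.continuous_sin.measurable.pow_const 2)
  have hii : ∀ a b : ℝ, a ≤ b → IntervalIntegrable (fun ψ : ℝ => φ (2 * Real.cos ψ) * Real.sin ψ ^ 2) volume a b := fun a b hab =>
    (intervalIntegrable_iff_integrableOn_Ioc_of_le hab).2
      (Measure.integrableOn_of_bounded measure_Ioc_lt_top.ne hpm.aestronglyMeasurable (ae_of_all _ hbdd))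
  have hnegm : Measurable fun ψ : ℝ => φ (-(2 * Real.cos ψ)) * Real.sin ψ ^ 2 :=
    (hφm.comp (Real.continuous_cos.measurable.const_mul 2).neg).mul (Real.continuous_sin.measurable.pow_const 2)
  have hI1 : IntegrableOn (fun ψ : ℝ => φ (2 * Real.cos ψ) * Real.sin ψ ^ 2) (Set.Ioo 0 (Real.pi / 2)) :=
    Measure.integrableOn_of_bounded measure_Ioo_lt_top.ne hpm.aestronglyMeasurable (ae_of_all _ hbdd)
  have hI2 : IntegrableOn (fun ψ : ℝ => φ (-(2 * Real.cos ψ)) * Real.sin ψ ^ 2) (Set.Ioo 0 (Real.pi / 2)) :=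
    Measure.integrableOn_of_bounded measure_Ioo_lt_top.ne hnegm.aestronglyMeasurable (ae_of_all _ fun ψ => by
      rw [Real.norm_eq_abs, abs_of_nonneg (mul_nonneg (hφ0 _) (sq_nonneg _))]
      calc φ (-(2 * Real.cos ψ)) * Real.sin ψ ^ 2 ≤ M * 1 := mul_le_mul (hφM _ (by linarith [(hcos ψ).2]) (by linarith [(hcos ψ).1])) (Real.sin_sq_le_one ψ) (sq_nonneg _) hM
        _ = M := mul_one M)
  have hF : ∫ ψ in Set.Ioo 0 (Real.pi / 2), (φ (2 * Real.cos ψ) + φ (-(2 * Real.cos ψ))) * Real.sin ψ ^ 2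
      = ∫ ψ in Set.Ioo 0 Real.pi, φ (2 * Real.cos ψ) * Real.sin ψ ^ 2 := by
    simp_rw [add_mul]
    rw [integral_add hI1 hI2]
    have hrefl := integral_reflect (fun c => φ (2 * c))
    simp only [mul_neg] at hrefl
    rw [hrefl, ← integral_Ioc_eq_integral_Ioo, ← intervalIntegral.integral_of_le (by linarith), ← integral_Ioc_eq_integral_Ioo,
      ← intervalIntegral.integral_of_le (by linarith), ← integral_Ioc_eq_integral_Ioo, ← intervalIntegral.integral_of_le (by linarith),
      intervalIntegral.integral_add_adjacent_intervals (hii _ _ (by linarith)) (hii _ _ (by linarith))]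
  -- Step G: assemble
  have hpos : 0 ≤ ∫ ψ in Set.Ioo 0 Real.pi, φ (2 * Real.cos ψ) * Real.sin ψ ^ 2 :=
    setIntegral_nonneg measurableSet_Ioo fun ψ _ => mul_nonneg (hφ0 _) (sq_nonneg _)
  rw [integral_eq_lintegral_of_nonneg_ae (ae_of_all _ fun U => hφ0 _) hGm.aestronglyMeasurable, hB, hcomp, hD, hE, hF,
    ← ENNReal.ofReal_mul (by positivity), ENNReal.toReal_ofReal (by positivity)]
  field_simp
  ring


/-- **THE ONE-PLAQUETTE PARTITION FUNCTION OF `SU(2)` IN WEYL's VARIABLE**: for `β ≥ 0`,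
`∫_{SU(2)} e^{−β·Re tr(1 − U)} dHaar(U) = (2∕π)·∫_{(0,π)} e^{−2β(1 − cos ψ)}·sin²ψ dψ` (the `Z(β) = e^{−2β}I₁(2β)∕β` of the refuter's instrument no. 7,
short of naming the Bessel function). [folklore] -/
theorem integral_exp_neg_traceDeficit_eq {β : ℝ} (hβ : 0 ≤ β) :
    ∫ U, Real.exp (-(β * (Matrix.trace (1 - (U : Matrix (Fin 2) (Fin 2) ℂ))).re)) ∂(haarProbability (Matrix.specialUnitaryGroup (Fin 2) ℂ))
      = 2 / Real.pi * ∫ ψ in Set.Ioo 0 Real.pi, Real.exp (-(2 * β * (1 - Real.cos ψ))) * Real.sin ψ ^ 2 := by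
  have htr : ∀ U : Matrix.specialUnitaryGroup (Fin 2) ℂ, (Matrix.trace (1 - (U : Matrix (Fin 2) (Fin 2) ℂ))).re = 2 - (Matrix.trace (U : Matrix (Fin 2) (Fin 2) ℂ)).re := fun U => by
    rw [Matrix.trace_sub, Matrix.trace_one, Complex.sub_re, Fintype.card_fin]; norm_num
  have h := integral_haar_su2_classFun (fun x : ℝ => Real.exp (-(β * (2 - x)))) (by fun_prop) (fun x => (Real.exp_pos _).le) (M := 1)
    (fun x _ hx2 => by rw [Real.exp_le_one_iff]; nlinarith)
  simp only [htr]
  rw [h]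
  congr 1
  refine setIntegral_congr_fun measurableSet_Ioo fun ψ _ => ?_
  congr 2; ring

end Summit.QuantumFields.BalabanUV.T4Continuum.NE7b.CompactFibreSU2ClassIntegral

end
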